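import Literature.AlgebraicGeometry.Hyperkaehler.GeneralizedKummerMonodromy
import Literature.AlgebraicGeometry.Surfaces.K3LatticeOrthogonalNegTwoVectorOrbits
import Literature.Topology.FourManifolds.LatticeFormsDivisorOneStabiliserQuotientOrbit
import Literature.Topology.FourManifolds.LatticeFormsPolarisationTypesGeneralDivisor
import Literature.Topology.FourManifolds.LatticeFormsStableOrthogonalGroupSmallDiscriminant
import Literature.Topology.FourManifolds.LatticeFormsStableEquivalence
import Literature.Topology.FourManifolds.LatticeFormsTwistDiscriminantGroup
import HarnessLib

/-!
# The `Kumⁿ` lattice `Λ_n = U^{⊕3} ⊕ ⟨−2(n+1)⟩` as an integral lattice: the model `3U ⊕ ⟨−2t⟩`, `t = n + 1`,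
# invariants `(3, 4)`, `D(Λ_n) ≅ ℤ/(2n+2)`, and the polarisation types of Gritsenko–Hulek–Sankaran
# (*Compositio Math.* 146 (2010) §4, Remark 4.15: "an identical classification for polarisations of deformations
# of generalised Kummer varieties")

Layer `Literature/AlgebraicGeometry/Hyperkaehler`. Written for lane `lit-hodgefound` (Track 2 foundations; prover seat
`lit-hodgefound-p18`, gen 43, rows g43-#6, g43-#10). THEOREMS ONLY — no definition, no named fact, no instance, no notation.

The tree's lattice OF RECORD for varieties of generalized Kummer deformation type is the Gram matrix
`Hyperkaehler.kumGram n = fromBlocks (U ⊕ U ⊕ U) 0 0 (−(2n+2))` on `KumIndex = (Fin 2 ⊕ (Fin 2 ⊕ Fin 2)) ⊕ Unit`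
(`GeneralizedKummerMonodromy.lean` §1: O'Grady §2, `H²(K_n(A); ℤ) = μ₂(H²(A; ℤ)) ⊕ ℤξ_n`, `(ξ_n, ξ_n) = −2(n+1)`,
`H²(A; ℤ) ≅ U^{⊕3}`; Markman §1.1). This file reads the integral bilinear form `Matrix.toBilin' (kumGram n)` through the
lattice files `Literature/Topology/FourManifolds/LatticeForms*.lean`, in which GHS's results of §4 are stated for
`B₀ ⊕ ⟨−2t⟩`, `B₀` even unimodular with two orthogonal hyperbolic planes, and for the coordinate models
`((pi fun _ : Fin m ↦ -e8Form).prod (hyperbolicSum (k + 2))).prod ((-(2t)) • LinearMap.mul ℤ ℤ)`. Here `B₀ = hyperbolicSum 3`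
(`= 3U`), `m = 0`, `k = 1`, and `t = n + 1` (so `t ≥ 1` for every `n`; no hypothesis on `n` is needed, the geometric
case being `n ≥ 2`).

## Sources, verbatim

* V. Gritsenko, K. Hulek, G. K. Sankaran, *Moduli spaces of irreducible symplectic manifolds*, Compositio Math. 146
  (2010) 404–434 (held text `paper:arxiv-0802.2078`, arXiv numbering). §4 is written for `L_{2t} = 3U ⊕ 2E₈(−1) ⊕ ⟨−2t⟩`;
  Remark 4.15 (p. 13, last sentence): "Since the classification of polarisation types in this section depends only on
  the discriminant group it immediately gives an identical classification for polarisations of deformations of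
  generalised Kummer varieties." The statements used: §4 (p. 10) "`div(h_d)` is a common divisor of `2d` and
  `2t = −det(L_{2t})`"; Lemma 4.5 (Eichler's criterion for a lattice "containing two orthogonal isotropic planes");
  Prop. 4.6 and its proof ("`h_d = f v + c l_{2t}`", "`c` is coprime to `f`", "`2d = 2bf² − 2c²t`", "the
  `Õ(L_{2t})`-orbit of `h_d` is … determined by `c mod f`", (iv) "`(h_d)^⊥ ≅ 2U ⊕ 2E₈(−1) ⊕ B`,
  `B = (−2b, c·2t/f ∕ c·2t/f, −2t)`"); Example 4.8 ("`f = 1` … only one `Õ(L_{2t})`-orbit of primitive vectors `h_d` with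
  `div(h_d) = 1`. Moreover `(h_d)^⊥ ≅ L_{2t,2d} = 2U ⊕ 2E₈(−1) ⊕ ⟨−2t⟩ ⊕ ⟨−2d⟩`"); Definition 4.9 ("split type");
  Example 4.10 ("`f = 2` … `h_d` exist if and only if `d + t ≡ 0 mod 4` … the `Õ(L_{2t})`-orbit of `h_d` is unique …
  `(h_d)^⊥ ≅ 2U ⊕ 2E₈(−1) ⊕ (−2b t ∕ t −2t)` where `4b = d + t`"); Example 4.11 ("if `(t, d) = 1`, then `f = div(h_d)` is
  equal to `1` or `2`"); Prop. 4.12 (ii) ("The factor group `O(L_{2t}, h_d)/Õ(L_{2t}, h_d)` is an abelian `2`-group,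
  which is of order `2^{ρ(t/f)}` if `f` is odd").
* V. Gritsenko, K. Hulek, G. K. Sankaran, *The Hirzebruch–Mumford volume for the orthogonal group and applications*,
  Doc. Math. 12 (2007): §4 Lemma 4.3 (`|O(q_{⟨−2t⟩})| = 2^{ρ(t)}`).
* E. Markman, *The monodromy of generalized Kummer varieties and algebraic cycles on their intermediate Jacobians*,
  JEMS 25 (2023) §1.1 (held text `paper:arxiv-1805.11574` p. 3): "The second cohomology `H²(Y, ℤ)` admits the symmetric
  bilinear Beauville–Bogomolov–Fujiki pairing. It has signature `(3, −4)`. […] The lattice `H²(Y, ℤ)` is not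
  unimodular. The residual group `H²(Y, ℤ)^*/H²(Y, ℤ)` is cyclic of order `dim Y + 2`" (`dim Y = 2n`).
* K. G. O'Grady, *Compact tori associated to hyperkähler manifolds of Kummer type*, IMRN 2021 §2: the form
  `(μ₂(α) + xξ_n, μ₂(β) + yξ_n) = ∫_A α∧β − 2(n+1)xy` — the definition of `kumGram` (`GeneralizedKummerMonodromy.lean`).

## Contents (all proved; `Λ_n := Matrix.toBilin' (kumGram n)`, `t = n + 1`)

* §1 **The model.** `toBilin'_kumGram_apply` (the form in coordinates); the explicit isometry
  `Λ_n ⥲ U^{⊕3} ⊕ ⟨−2(n+1)⟩ = (hyperbolicSum 3).prod ((-(2(n+1))) • mul)`, `v ↦ ((x-coordinates, y-coordinates), v_ξ)`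
  (`exists_isometryEquiv_toBilin'_kumGram`), and `Λ_n ≅ (E₈(−1)^{⊕0} ⊕ U^{⊕3}) ⊕ ⟨−2(n+1)⟩`, the `m = 0` coordinate model of
  the lattice files (`toBilin'_kumGram_equivalent_model`).
* §2 **Invariants.** Symmetric, even, rank `7`, nondegenerate, not unimodular, signature `(3, 4)` (index `−1`),
  `|D(Λ_n)| = 2n + 2`, `D(Λ_n) ≅ ℤ/(2n+2)` (cyclic).
* §3 **Polarisation types (GHS 2010 §4 with Remark 4.15) in `Λ_n`.** `div(h) ∣ 2(n+1)` for primitive `h`;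
  Example 4.11 (`gcd(n+1, d) = 1 ⟹` split or `div = 2`); Example 4.8 (split vectors of equal square lie in one
  `Õ(Λ_n)`-orbit; exactly one orbit in each degree `2d`; the complement `h^⊥ ≅ (2U ⊕ ⟨−2d⟩) ⊕ ⟨−2(n+1)⟩`); Example 4.10
  (non-split vectors with `div = 2`: `h_ξ` odd and `4 ∣ d + (n+1)`; existence; one `Õ(Λ_n)`-orbit;
  `#orbits = if 4 ∣ d + (n+1) then 1 else 0`; complement `≅ 2U ⊕ (−2b t ∕ t −2t)`); `|O(q_{Λ_n})| = 2^{ρ(n+1)}`;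
  Prop. 4.12 (ii), `f = 1`: for every split `h` with `h² ≠ 0`, `#(O(Λ_n, h)|_{h^⊥} ∕ Õ) = 2^{ρ(n+1)}`.
* §4 **Prop. 4.6 for a general divisor `f` in `Λ_n`**: `gcd(f, h_ξ) = 1` for primitive `h` with `f ∣ (h, Λ_n)`,
  `f² ∣ d + (n+1)h_ξ²`, the number of `Õ(Λ_n)`-orbits of primitive `h` with `h² = 2d`, `(h, Λ_n) = fℤ` equals
  `#{c mod f : (c, f) = 1, f² ∣ d + (n+1)c²}` (`f ∣ 2(n+1)`), and (iv) `h^⊥ ≅ 2U ⊕ (−2b a ∕ a −2(n+1))`,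
  `f²b = d + (n+1)h_ξ²`, `fa = 2(n+1)h_ξ`.

* §5 **Kummer fourfolds (`n = 2`, `Λ_2 = 3U ⊕ ⟨−6⟩`, `|A| = 6`)** (appended, row g43-#10): `div(h) ∣ 6`; `3 ∤ d ⟹` split or
  `div = 2`; the `Õ(Λ_2)`-orbit counts of primitive `h` with `h² = 2d` EVALUATED: `div = 2`: `1` if `4 ∣ d + 3` else `0`;
  `div = 3`: `2` if `9 ∣ d + 3` else `0`; `div = 6`: `2` if `36 ∣ d + 3` else `0`; existence iff `9 ∣ d + 3` resp.
  `36 ∣ d + 3`; complements `2U ⊕ (−2b 2c ∕ 2c −6)` (`9b = d + 3c²`) and `2U ⊕ (−2b c ∕ c −6)` (`36b = d + 3c²`), `c = h_ξ`.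

Not here: the closed-form evaluation Prop. 4.6 (i)–(iii) for general `n`; the geometric identification `H²(Y, ℤ) ≅ Λ_n` (the named
fact `Rapagnetta2008_exists_isMarkedKum`, `BeauvilleBogomolovMarkingsExist.lean`); monodromy (`GeneralizedKummerMonodromy.lean`,
`ReflectionGroupDiscriminantCharacter*.lean`).

## References

* [GritsenkoHulekSankaran2010Symplectic] V. Gritsenko, K. Hulek, G. K. Sankaran, Moduli spaces of irreducible
  symplectic manifolds, Compositio Math. 146 (2010) 404–434: §4 Lemma 4.5, Prop. 4.6, Examples 4.8, 4.10, 4.11,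
  Def. 4.9, Prop. 4.12 (ii), Remark 4.15.
* [GritsenkoHulekSankaran2007HM] V. Gritsenko, K. Hulek, G. K. Sankaran, The Hirzebruch–Mumford volume for the
  orthogonal group and applications, Doc. Math. 12 (2007): §4 Lemma 4.3.
* [Markman2023GeneralizedKummers] E. Markman, The monodromy of generalized Kummer varieties and algebraic cycles on
  their intermediate Jacobians, JEMS 25 (2023) 231–321: §1.1 p. 234.
* [OGrady2021KummerTori] K. G. O'Grady, Compact tori associated to hyperkähler manifolds of Kummer type, IMRN 2021
  no. 16, 12356–12419: §2.
* [Huybrechts2016K3] D. Huybrechts, Lectures on K3 Surfaces, CUP 2016: Ch. 14 §0.3 (ii), (iv).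
-/

noncomputable section

open Module Function Sum
open LinearMap (BilinForm)
open LinearMap.BilinForm
open Literature.Topology.FourManifolds
open Literature.AlgebraicGeometry.Surfaces

namespace Literature.AlgebraicGeometry.Hyperkaehler

/-! ### §1 The model `Λ_n ≅ U^{⊕3} ⊕ ⟨−2(n+1)⟩` -/

/-- Evaluation of the `Kumⁿ` form in the basis `e₁, f₁, e₂, f₂, e₃, f₃, ξ` of `U ⊕ U ⊕ U ⊕ ⟨−2(n+1)⟩`:
`Λ_n(v, w) = Σ_k (v_{e_k} w_{f_k} + v_{f_k} w_{e_k}) − (2n+2) v_ξ w_ξ` ("`(μ₂(α) + xξ_n, μ₂(β) + yξ_n) = ∫_A α∧β − 2(n+1)xy`").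
[cite: OGrady2021KummerTori, §2 (the BBF form of `K_n(A)`)] [cite: Markman2023GeneralizedKummers, §1.1 p. 234] -/
theorem toBilin'_kumGram_apply (n : ℕ) (v w : KumIndex → ℤ) :
    Matrix.toBilin' (kumGram n) v w =
      (v (inl (inl 0)) * w (inl (inl 1)) + v (inl (inl 1)) * w (inl (inl 0))) +
      (v (inl (inr (inl 0))) * w (inl (inr (inl 1))) + v (inl (inr (inl 1))) * w (inl (inr (inl 0)))) +
      (v (inl (inr (inr 0))) * w (inl (inr (inr 1))) + v (inl (inr (inr 1))) * w (inl (inr (inr 0)))) +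
      -(2 * (n : ℤ) + 2) * (v (inr ()) * w (inr ())) := by
  simp only [Matrix.toBilin'_apply, Fintype.sum_sum_type, Fin.sum_univ_two, kumGram, Surfaces.hyperbolicPlaneGram,
    Matrix.fromBlocks_apply₁₁, Matrix.fromBlocks_apply₁₂, Matrix.fromBlocks_apply₂₁, Matrix.fromBlocks_apply₂₂,
    Matrix.zero_apply, mul_zero, zero_mul, add_zero, zero_add, Matrix.of_apply, Fintype.sum_unique,
    PUnit.default_eq_unit, Matrix.cons_val', Matrix.cons_val_zero, Matrix.cons_val_one,
    Matrix.empty_val', Matrix.cons_val_fin_one, mul_one]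
  ring

/-- **`Λ_n ⥲ U^{⊕3} ⊕ ⟨−2(n+1)⟩`, `v ↦ ((v_{e_1}, v_{e_2}, v_{e_3}), (v_{f_1}, v_{f_2}, v_{f_3})), v_ξ)`**: the `Kumⁿ` lattice of
record is the orthogonal sum of three hyperbolic planes (the coordinate model `hyperbolicSum 3`,
`((x, y), (x', y')) ↦ x·y' + y·x'`) and `⟨−2(n+1)⟩` ("`H²(K_n(A); ℤ) = μ₂(H²(A; ℤ)) ⊕ ℤξ_n`", `H²(A; ℤ) ≅ U^{⊕3}`; GHS's
`3U ⊕ ⟨−2t⟩` with `t = n + 1`). [cite: OGrady2021KummerTori, §2] [cite: GritsenkoHulekSankaran2010Symplectic, §4 Remark 4.15] -/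
theorem exists_isometryEquiv_toBilin'_kumGram (n : ℕ) :
    ∃ ψ : (Matrix.toBilin' (kumGram n)).IsometryEquiv
        ((hyperbolicSum 3).prod ((-(2 * (n + 1 : ℕ) : ℤ)) • LinearMap.mul ℤ ℤ)),
      ∀ v, (ψ v).1.1 = ![v (inl (inl 0)), v (inl (inr (inl 0))), v (inl (inr (inr 0)))] ∧
        (ψ v).1.2 = ![v (inl (inl 1)), v (inl (inr (inl 1))), v (inl (inr (inr 1)))] ∧ (ψ v).2 = v (inr ()) := by
  let σ : (Fin 3 ⊕ Fin 3) ⊕ Unit ≃ KumIndex :=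
    { toFun := fun
        | inl (inl i) => inl (![inl 0, inr (inl 0), inr (inr 0)] i)
        | inl (inr i) => inl (![inl 1, inr (inl 1), inr (inr 1)] i)
        | inr u => inr u
      invFun := fun
        | inl (inl j) => inl (![inl 0, inr 0] j)
        | inl (inr (inl j)) => inl (![inl 1, inr 1] j)
        | inl (inr (inr j)) => inl (![inl 2, inr 2] j)
        | inr u => inr u
      left_inv := by decide
      right_inv := by decide }
  let L : (KumIndex → ℤ) ≃ₗ[ℤ] ((Fin 3 → ℤ) × (Fin 3 → ℤ)) × ℤ :=
    (LinearEquiv.funCongrLeft ℤ ℤ σ).trans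
      ((LinearEquiv.sumArrowLequivProdArrow (Fin 3 ⊕ Fin 3) Unit ℤ ℤ).trans
        ((LinearEquiv.sumArrowLequivProdArrow (Fin 3) (Fin 3) ℤ ℤ).prodCongr (LinearEquiv.funUnique Unit ℤ ℤ)))
  have hL : ∀ v, L v = ((![v (inl (inl 0)), v (inl (inr (inl 0))), v (inl (inr (inr 0)))],
      ![v (inl (inl 1)), v (inl (inr (inl 1))), v (inl (inr (inr 1)))]), v (inr ())) := fun v ↦
    Prod.ext (Prod.ext (funext fun i ↦ by fin_cases i <;> rfl) (funext fun i ↦ by fin_cases i <;> rfl)) rfl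
  refine ⟨{ L with map_app' := fun v w ↦ ?_ }, fun v ↦ ?_⟩
  · change ((hyperbolicSum 3).prod _) (L v) (L w) = Matrix.toBilin' (kumGram n) v w
    rw [hL, hL, prod_neg_twoMul_smul_mul_apply, hyperbolicSum_apply, toBilin'_kumGram_apply]
    simp only [Matrix.cons_dotProduct_cons, Matrix.dotProduct_of_isEmpty]
    push_cast
    ring
  · change (L v).1.1 = _ ∧ (L v).1.2 = _ ∧ (L v).2 = _
    rw [hL]
    exact ⟨rfl, rfl, rfl⟩

/-- `E₈(−1)^{⊕0} ⊕ Q ⥲ Q`, `p ↦ p.2`: dropping the rank-`0` factor of the `m = 0` coordinate model (plumbing). [folklore] -/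
private theorem exists_isometryEquiv_pi_finZero_prod {X : Type*} [AddCommGroup X] (Q : BilinForm ℤ X) :
    ∃ u : ((LinearMap.BilinForm.pi fun _ : Fin 0 ↦ -e8Form).prod Q).IsometryEquiv Q, ∀ p, u p = p.2 := by
  refine ⟨{ (LinearEquiv.uniqueProd : ((Fin 0 → Fin 8 → ℤ) × X) ≃ₗ[ℤ] X) with map_app' := fun p q ↦ ?_ }, fun p ↦ rfl⟩
  change Q p.2 q.2 = ((LinearMap.BilinForm.pi fun _ : Fin 0 ↦ -e8Form).prod Q) p q
  rw [LinearMap.BilinForm.prod_apply, LinearMap.BilinForm.pi_apply, Finset.univ_eq_empty, Finset.sum_empty, zero_add]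

/-- `E₈(−1)^{⊕0} ⊕ Q ≅ Q` (the `m = 0` coordinate model of the lattice files, rank-`0` factor dropped; plumbing). [folklore] -/
private theorem pi_finZero_prod_equivalent {X : Type*} [AddCommGroup X] (Q : BilinForm ℤ X) :
    ((LinearMap.BilinForm.pi fun _ : Fin 0 ↦ -e8Form).prod Q).Equivalent Q := by
  obtain ⟨u, -⟩ := exists_isometryEquiv_pi_finZero_prod Q
  exact ⟨u⟩

/-- **`Λ_n ≅ (E₈(−1)^{⊕0} ⊕ U^{⊕3}) ⊕ ⟨−2(n+1)⟩`** — the `Kumⁿ` lattice in the coordinate model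
`((pi fun _ : Fin m ↦ -e8Form).prod (hyperbolicSum (k + 2))).prod ((-(2t)) • mul)` of the lattice files with `m = 0`, `k = 1`,
`t = n + 1` (GHS's `L_{2t}` has `m = 2`; "an identical classification for … generalised Kummer varieties"), by an
isometry preserving the `ξ`-coordinate. [cite: GritsenkoHulekSankaran2010Symplectic, §4 Remark 4.15] [cite: OGrady2021KummerTori, §2] -/
theorem exists_isometryEquiv_toBilin'_kumGram_model (n : ℕ) :
    ∃ φ : (Matrix.toBilin' (kumGram n)).IsometryEquiv
        (((LinearMap.BilinForm.pi fun _ : Fin 0 ↦ -e8Form).prod (hyperbolicSum 3)).prod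
          ((-(2 * (n + 1 : ℕ) : ℤ)) • LinearMap.mul ℤ ℤ)), ∀ v, (φ v).2 = v (inr ()) := by
  obtain ⟨ψ, hψ⟩ := exists_isometryEquiv_toBilin'_kumGram n
  obtain ⟨u, -⟩ := exists_isometryEquiv_pi_finZero_prod (hyperbolicSum 3)
  refine ⟨ψ.trans (u.symm.prodCongr (LinearMap.BilinForm.IsometryEquiv.refl _)), fun v ↦ ?_⟩
  rw [LinearMap.BilinForm.IsometryEquiv.trans_apply, LinearMap.BilinForm.IsometryEquiv.prodCongr_apply]
  exact (hψ v).2.2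

/-- **`Λ_n ≅ (E₈(−1)^{⊕0} ⊕ U^{⊕3}) ⊕ ⟨−2(n+1)⟩`** as an isometry class. [cite: GritsenkoHulekSankaran2010Symplectic, §4 Remark 4.15] [cite: OGrady2021KummerTori, §2] -/
theorem toBilin'_kumGram_equivalent_model (n : ℕ) :
    (Matrix.toBilin' (kumGram n)).Equivalent
      (((LinearMap.BilinForm.pi fun _ : Fin 0 ↦ -e8Form).prod (hyperbolicSum 3)).prod
        ((-(2 * (n + 1 : ℕ) : ℤ)) • LinearMap.mul ℤ ℤ)) := by
  obtain ⟨φ, -⟩ := exists_isometryEquiv_toBilin'_kumGram_model n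
  exact ⟨φ⟩

/-! ### §2 Invariants: even, rank `7`, signature `(3, 4)`, `D(Λ_n) ≅ ℤ/(2n+2)` -/

/-- `Λ_n` is symmetric ("the symmetric bilinear Beauville–Bogomolov–Fujiki pairing"). [cite: Markman2023GeneralizedKummers, §1.1 p. 234] -/
theorem isSymm_toBilin'_kumGram (n : ℕ) : (Matrix.toBilin' (kumGram n)).IsSymm :=
  Matrix.isSymm_toBilin'_iff_isSymm.mpr (kumGram_transpose n)

/-- `Λ_n` is even (`v² = 2Σ_k v_{e_k}v_{f_k} − 2(n+1)v_ξ²`; GHS §4: "Let `L` be an even lattice").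
[cite: GritsenkoHulekSankaran2010Symplectic, §4 (first paragraph) and Remark 4.15] -/
theorem isEven_toBilin'_kumGram (n : ℕ) : (Matrix.toBilin' (kumGram n)).IsEven := fun v ↦
  ⟨v (inl (inl 0)) * v (inl (inl 1)) + v (inl (inr (inl 0))) * v (inl (inr (inl 1))) +
    v (inl (inr (inr 0))) * v (inl (inr (inr 1))) - (n + 1) * (v (inr ()) * v (inr ())), by
    rw [toBilin'_kumGram_apply]; ring⟩

/-- `rk Λ_n = 7` (`= b₂` of a `Kumⁿ`-type variety). [cite: Markman2023GeneralizedKummers, §1.1 p. 234 (signature `(3, 4)`)] -/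
theorem finrank_kumIndex_fun : finrank ℤ (KumIndex → ℤ) = 7 := by
  rw [Module.finrank_fintype_fun_eq_card, card_kumIndex]

/-- `Λ_n` is nondegenerate (`det Λ_n = 2n + 2 ≠ 0`; "By lattice … we always mean a non-degenerate lattice").
[cite: GritsenkoHulekSankaran2010Symplectic, §4 (first paragraph) and Remark 4.15] -/
theorem nondegenerate_toBilin'_kumGram (n : ℕ) : (Matrix.toBilin' (kumGram n)).Nondegenerate := by
  obtain ⟨ψ, -⟩ := exists_isometryEquiv_toBilin'_kumGram n
  exact ψ.symm.nondegenerate (nondegenerate_prod_neg_twoMul_smul_mul _ (n + 1) (isUnimodular_hyperbolicSum 3) (Nat.succ_pos n))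

/-- **`|D(Λ_n)| = 2n + 2`** ("The residual group `H²(Y, ℤ)^*/H²(Y, ℤ)` is cyclic of order `dim Y + 2`", `dim Y = 2n`;
GHS: "`2t = −det(L_{2t})`"). [cite: Markman2023GeneralizedKummers, §1.1 p. 234] [cite: GritsenkoHulekSankaran2010Symplectic, §4 (before Prop. 4.6) and Remark 4.15] -/
theorem natCard_discriminantGroup_toBilin'_kumGram (n : ℕ) :
    Nat.card (Matrix.toBilin' (kumGram n)).discriminantGroup = 2 * n + 2 := by
  obtain ⟨ψ, -⟩ := exists_isometryEquiv_toBilin'_kumGram n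
  rw [Nat.card_congr ψ.discriminantGroupCongr.toEquiv, natCard_discriminantGroup_prod_neg_twoMul_smul_mul _ (n + 1)
    (isUnimodular_hyperbolicSum 3)]
  ring

/-- **"The lattice `H²(Y, ℤ)` is not unimodular"** (`|D(Λ_n)| = 2n + 2 ≥ 2`). [cite: Markman2023GeneralizedKummers, §1.1 p. 234] -/
theorem not_isUnimodular_toBilin'_kumGram (n : ℕ) : ¬ (Matrix.toBilin' (kumGram n)).IsUnimodular := by
  intro hu
  have h1 := (isUnimodular_iff_natCard_discriminantGroup_eq_one _ (nondegenerate_toBilin'_kumGram n)).1 hu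
  rw [natCard_discriminantGroup_toBilin'_kumGram] at h1
  omega

/-- **"The residual group `H²(Y, ℤ)^*/H²(Y, ℤ)` is cyclic of order `dim Y + 2`": `D(Λ_n) ≅ ℤ/(2n+2)`** — here from
`D(3U ⊕ ⟨−2(n+1)⟩) ≅ D(⟨−2(n+1)⟩) ≅ ℤ/(2n+2)` (`3U` unimodular). [cite: Markman2023GeneralizedKummers, §1.1 p. 234] [cite: Huybrechts2016K3, Ch. 14 §0.3 (iv)] -/
theorem nonempty_discriminantGroup_addEquiv_zmod_toBilin'_kumGram (n : ℕ) :
    Nonempty ((Matrix.toBilin' (kumGram n)).discriminantGroup ≃+ ZMod (2 * n + 2)) := by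
  obtain ⟨ψ, -⟩ := exists_isometryEquiv_toBilin'_kumGram n
  haveI : (hyperbolicSum 3).IsPerfPair := isUnimodular_hyperbolicSum 3
  haveI := (hyperbolicSum 3).subsingleton_discriminantGroup
  haveI : Unique (hyperbolicSum 3).discriminantGroup := uniqueOfSubsingleton 0
  have hm : (-(2 * (n + 1 : ℕ) : ℤ)).natAbs = 2 * n + 2 := by
    rw [Int.natAbs_neg, show (2 * (n + 1 : ℕ) : ℤ) = ((2 * n + 2 : ℕ) : ℤ) by push_cast; ring, Int.natAbs_natCast]
  let e₁ : (Matrix.toBilin' (kumGram n)).discriminantGroup ≃+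
      (hyperbolicSum 3).discriminantGroup ×
        LinearMap.BilinForm.discriminantGroup ((-(2 * (n + 1 : ℕ) : ℤ)) • LinearMap.mul ℤ ℤ) :=
    ψ.discriminantGroupCongr.toAddEquiv.trans
      ((hyperbolicSum 3).discriminantGroupProdEquiv ((-(2 * (n + 1 : ℕ) : ℤ)) • LinearMap.mul ℤ ℤ)).symm.toAddEquiv
  let e₂ : LinearMap.BilinForm.discriminantGroup ((-(2 * (n + 1 : ℕ) : ℤ)) • LinearMap.mul ℤ ℤ) ≃+
      (Unit → ZMod (-(2 * (n + 1 : ℕ) : ℤ)).natAbs) :=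
    (LinearMap.BilinForm.discriminantGroupSmulEquivPiZMod (LinearMap.mul ℤ ℤ) (-(2 * (n + 1 : ℕ) : ℤ)) isUnimodular_mul
      (Basis.singleton Unit ℤ)).toAddEquiv
  exact ⟨e₁.trans (AddEquiv.uniqueProd.trans (e₂.trans ((AddEquiv.piUnique fun _ : Unit ↦ ZMod _).trans
    (ZMod.ringEquivCongr hm).toAddEquiv)))⟩

/-- `D(Λ_n)` is a cyclic group. [cite: Markman2023GeneralizedKummers, §1.1 p. 234] -/
theorem isAddCyclic_discriminantGroup_toBilin'_kumGram (n : ℕ) :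
    IsAddCyclic (Matrix.toBilin' (kumGram n)).discriminantGroup := by
  obtain ⟨e⟩ := nonempty_discriminantGroup_addEquiv_zmod_toBilin'_kumGram n
  exact isAddCyclic_of_surjective e.symm.toAddMonoidHom e.symm.surjective

/-- **`Λ_n` has signature `(3, 4)`** ("It has signature `(3, −4)`": `3U` contributes `(3, 3)`, `⟨−2(n+1)⟩` contributes
`(0, 1)`). [cite: Markman2023GeneralizedKummers, §1.1 p. 234] -/
theorem sigPos_sigNeg_toBilin'_kumGram (n : ℕ) :
    sigPos (Matrix.toBilin' (kumGram n)).toQuadraticMap = 3 ∧ sigNeg (Matrix.toBilin' (kumGram n)).toQuadraticMap = 4 := by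
  obtain ⟨ψ, -⟩ := exists_isometryEquiv_toBilin'_kumGram n
  have hq : (Matrix.toBilin' (kumGram n)).toQuadraticMap.Equivalent
      ((hyperbolicSum 3).prod ((-(2 * (n + 1 : ℕ) : ℤ)) • LinearMap.mul ℤ ℤ)).toQuadraticMap :=
    ⟨{ ψ.toLinearEquiv with map_app' := fun x ↦ ψ.map_app x x }⟩
  obtain ⟨hp', hn'⟩ := sigPos_sigNeg_neg_two_mul_smul_mul (d := ((n + 1 : ℕ) : ℤ)) (by positivity)
  obtain ⟨hp3, hn3⟩ := sigPos_sigNeg_hyperbolicSum 3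
  rw [hq.sigPos_eq, hq.sigNeg_eq, sigPos_prod _ _ (isSymm_hyperbolicSum 3) (isSymm_smul_mul _),
    sigNeg_prod _ _ (isSymm_hyperbolicSum 3) (isSymm_smul_mul _), hp3, hn3, hp', hn']
  norm_num

/-- **The index: `τ(Λ_n) = 3 − 4 = −1`.** [cite: Markman2023GeneralizedKummers, §1.1 p. 234 (signature `(3, −4)`)] -/
theorem signature_toBilin'_kumGram (n : ℕ) : (Matrix.toBilin' (kumGram n)).signature = -1 := by
  obtain ⟨hp, hq⟩ := sigPos_sigNeg_toBilin'_kumGram n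
  change (sigPos _ : ℤ) - sigNeg _ = -1
  rw [hp, hq]
  norm_num

/-- `Λ_n` is indefinite of real rank `≥ 3` on both sides: it contains the two orthogonal hyperbolic planes `U₁ ⊕ U₂ ⊂ 3U`
to which Eichler's criterion (GHS Lemma 4.5, "Let `L` be a lattice containing two orthogonal isotropic planes") applies.
[cite: GritsenkoHulekSankaran2010Symplectic, §4 Lemma 4.5 and Remark 4.15] -/
theorem exists_twoHyperbolicPairs_toBilin'_kumGram (n : ℕ) :
    ∃ x y x₁ y₁ : KumIndex → ℤ, TwoHyperbolicPairs (Matrix.toBilin' (kumGram n)) x y x₁ y₁ := by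
  obtain ⟨ψ, -⟩ := exists_isometryEquiv_toBilin'_kumGram n
  exact ⟨_, _, _, _, TwoHyperbolicPairs.of_isometryEquiv (isSymm_toBilin'_kumGram n) ψ
    (TwoHyperbolicPairs.inl (isSymm_smul_mul _) (twoHyperbolicPairs_hyperbolicSum (show (1 : Fin 3) ≠ 0 by decide)))⟩

/-! ### §3 Polarisation types in `Λ_n` (GHS 2010 §4 via Remark 4.15), `t = n + 1` -/

section PolarisationTypes

variable {n : ℕ}

/-- **"`div(h_d)` is a common divisor of `2d` and `2t = −det(L_{2t})`"** in `Λ_n`: if `h ∈ Λ_n` is primitive and `δ`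
divides every product `(h, z)`, then `δ ∣ 2(n + 1)`. [cite: GritsenkoHulekSankaran2010Symplectic, §4 (before Prop. 4.6) and Remark 4.15] -/
theorem kum_dvd_two_mul_of_forall_dvd_of_primitive {h : KumIndex → ℤ} {δ : ℤ} (hh0 : h ≠ 0)
    (hsat : ∀ (k : ℤ) (w : KumIndex → ℤ), k ≠ 0 → k • w ∈ ℤ ∙ h → w ∈ ℤ ∙ h)
    (hδ : ∀ z, δ ∣ Matrix.toBilin' (kumGram n) h z) : δ ∣ 2 * (n + 1 : ℕ) := by
  obtain ⟨ψ, -⟩ := exists_isometryEquiv_toBilin'_kumGram n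
  have h0 : ψ h ≠ 0 := fun h1 ↦ hh0 (ψ.toLinearEquiv.map_eq_zero_iff.1 h1)
  exact dvd_two_mul_of_forall_dvd_of_primitive (n + 1) (isUnimodular_hyperbolicSum 3) h0
    (forall_mem_span_singleton_apply_of_isometryEquiv ψ hsat) ((forall_dvd_apply_iff_of_isometryEquiv ψ h δ).2 hδ)

/-- **Example 4.11 in `Λ_n`: "if `(t, d) = 1`, then `f = div(h_d)` is equal to `1` or `2`"** (`t = n + 1`) — a primitive
`h ∈ Λ_n` with `h² = 2d`, `gcd(n + 1, d) = 1`, is split (`(h, h') = 1` for some `h'`) or has `(h, Λ_n) = 2ℤ`.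
[cite: GritsenkoHulekSankaran2010Symplectic, §4 Example 4.11 and Remark 4.15] -/
theorem kum_exists_apply_eq_one_or_forall_two_dvd_of_gcd_eq_one {h : KumIndex → ℤ} {d : ℤ}
    (hh : Matrix.toBilin' (kumGram n) h h = 2 * d) (hh0 : h ≠ 0)
    (hsat : ∀ (k : ℤ) (w : KumIndex → ℤ), k ≠ 0 → k • w ∈ ℤ ∙ h → w ∈ ℤ ∙ h)
    (htd : Int.gcd ((n + 1 : ℕ) : ℤ) d = 1) :
    (∃ h', Matrix.toBilin' (kumGram n) h h' = 1) ∨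
      ((∀ z, (2 : ℤ) ∣ Matrix.toBilin' (kumGram n) h z) ∧ ∃ h', Matrix.toBilin' (kumGram n) h h' = 2) := by
  obtain ⟨ψ, -⟩ := exists_isometryEquiv_toBilin'_kumGram n
  have h0 : ψ h ≠ 0 := fun h1 ↦ hh0 (ψ.toLinearEquiv.map_eq_zero_iff.1 h1)
  have h1 := exists_apply_eq_one_or_forall_two_dvd_of_isCoprime (n + 1) (isUnimodular_hyperbolicSum 3) (r := ψ h)
    (d := d) (by rw [ψ.map_app, hh]) h0 (forall_mem_span_singleton_apply_of_isometryEquiv ψ hsat) htd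
  rwa [exists_apply_eq_iff_of_isometryEquiv ψ h 1, exists_apply_eq_iff_of_isometryEquiv ψ h 2,
    forall_dvd_apply_iff_of_isometryEquiv ψ h 2] at h1

/-- **Example 4.8 in `Λ_n`, the orbit: split vectors of the same square lie in ONE `Õ(Λ_n)`-orbit** ("for any `t` and `d`
there is only one `Õ(L_{2t})`-orbit of primitive vectors `h_d` with `div(h_d) = 1`"; Eichler's criterion in `3U ⊕ ⟨−2t⟩`).
[cite: GritsenkoHulekSankaran2010Symplectic, §4 Example 4.8 and Remark 4.15] -/
theorem kum_exists_stable_isometryEquiv_apply_eq_of_apply_eq_one {u v u' v' : KumIndex → ℤ}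
    (huv : Matrix.toBilin' (kumGram n) u u = Matrix.toBilin' (kumGram n) v v)
    (hu' : Matrix.toBilin' (kumGram n) u u' = 1) (hv' : Matrix.toBilin' (kumGram n) v v' = 1) :
    ∃ g : (Matrix.toBilin' (kumGram n)).IsometryEquiv (Matrix.toBilin' (kumGram n)),
      g.discriminantGroupCongr = LinearEquiv.refl ℤ _ ∧ g u = v := by
  obtain ⟨ψ, -⟩ := exists_isometryEquiv_toBilin'_kumGram n
  have hP := twoHyperbolicPairs_hyperbolicSum (show (1 : Fin 3) ≠ 0 by decide)
  obtain ⟨g₀, hg₀, hg₀u⟩ := exists_stable_isometryEquiv_apply_eq_of_apply_eq_one_of_apply_eq_one (n + 1)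
    (isUnimodular_hyperbolicSum 3) (isEven_hyperbolicSum 3) (Nat.succ_pos n) hP (u := ψ u) (v := ψ v) (u' := ψ u')
    (v' := ψ v') (by rw [ψ.map_app, ψ.map_app, huv]) (by rw [ψ.map_app, hu']) (by rw [ψ.map_app, hv'])
  refine ⟨ψ.trans (g₀.trans ψ.symm), discriminantGroupCongr_trans_trans_symm_eq_refl ψ hg₀, ?_⟩
  rw [LinearMap.BilinForm.IsometryEquiv.trans_apply, LinearMap.BilinForm.IsometryEquiv.trans_apply, hg₀u]
  exact ψ.toLinearEquiv.symm_apply_apply v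

/-- **Example 4.8 in `Λ_n` as a count: the split vectors of square `2d` form exactly one `Õ(Λ_n)`-orbit** (every
`d ∈ ℤ`; Definition 4.9: "split type if `div(h) = 1`"). [cite: GritsenkoHulekSankaran2010Symplectic, §4 Example 4.8, Definition 4.9 and Remark 4.15] -/
theorem kum_natCard_quot_stable_isometryEquiv_of_apply_eq_one (n : ℕ) (d : ℤ) :
    Nat.card (Quot fun r s : {r : KumIndex → ℤ // Matrix.toBilin' (kumGram n) r r = 2 * d ∧
        ∃ r', Matrix.toBilin' (kumGram n) r r' = 1} ↦
      ∃ g : (Matrix.toBilin' (kumGram n)).IsometryEquiv (Matrix.toBilin' (kumGram n)),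
        g.discriminantGroupCongr = LinearEquiv.refl ℤ _ ∧ g r.1 = s.1) = 1 := by
  obtain ⟨ψ, -⟩ := exists_isometryEquiv_toBilin'_kumGram n
  have hP := twoHyperbolicPairs_hyperbolicSum (show (1 : Fin 3) ≠ 0 by decide)
  rw [natCard_quot_stable_isometryEquiv_eq_of_isometryEquiv ψ _
    (fun r ↦ (hyperbolicSum 3).prod ((-(2 * (n + 1 : ℕ) : ℤ)) • LinearMap.mul ℤ ℤ) r r = 2 * d ∧
      ∃ r', (hyperbolicSum 3).prod ((-(2 * (n + 1 : ℕ) : ℤ)) • LinearMap.mul ℤ ℤ) r r' = 1)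
    (fun r ↦ by rw [ψ.map_app, exists_apply_eq_iff_of_isometryEquiv ψ r 1])]
  exact natCard_quot_stable_isometryEquiv_two_mul_of_apply_eq_one (n + 1) (isUnimodular_hyperbolicSum 3)
    (isEven_hyperbolicSum 3) (Nat.succ_pos n) hP d

/-- **Example 4.8 in `Λ_n`, the complement: `h^⊥ ≅ 2U ⊕ ⟨−2t⟩ ⊕ ⟨−2d⟩`** (GHS's `L_{2t,2d}` without the `E₈(−1)` summands),
for every split `h ∈ Λ_n` (`h² = 2d`, `(h, h') = 1`; bracketed `((2U) ⊕ ⟨−2d⟩) ⊕ ⟨−2(n+1)⟩`).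
[cite: GritsenkoHulekSankaran2010Symplectic, §4 Example 4.8 and Remark 4.15] -/
theorem kum_restrict_orthogonal_equivalent_of_apply_eq_one {h h' : KumIndex → ℤ} {d : ℤ}
    (hh : Matrix.toBilin' (kumGram n) h h = 2 * d) (hh' : Matrix.toBilin' (kumGram n) h h' = 1) :
    ((Matrix.toBilin' (kumGram n)).restrict ((Matrix.toBilin' (kumGram n)).orthogonal (ℤ ∙ h))).Equivalent
      (((hyperbolicSum 2).prod ((-(2 * d)) • LinearMap.mul ℤ ℤ)).prod ((-(2 * (n + 1 : ℕ) : ℤ)) • LinearMap.mul ℤ ℤ)) := by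
  obtain ⟨φ⟩ := toBilin'_kumGram_equivalent_model n
  exact ((restrict_orthogonal_equivalent_of_isometryEquiv φ h).trans
    (restrict_orthogonal_model_equivalent_of_apply_eq_one 0 1 (n + 1) (Nat.succ_pos n) (r := φ h) (r' := φ h')
      (by rw [φ.map_app, hh]) (by rw [φ.map_app, hh']))).trans
    (((pi_finZero_prod_equivalent _).prod (Equivalent.refl _)).prod (Equivalent.refl _))

/-- **Example 4.10 in `Λ_n`, necessity: a primitive `h ∈ Λ_n` with `h² = 2d` and `(h, Λ_n) ⊆ 2ℤ` has odd `ξ`-coordinate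
(`h = 2v + cξ`, "`c` is odd") and `d + (n + 1) ≡ 0 (mod 4)`** ("a constant `b` and a vector `h_d` exist if and only if
`d + t ≡ 0 mod 4`"). [cite: GritsenkoHulekSankaran2010Symplectic, §4 Example 4.10 and Remark 4.15] -/
theorem kum_odd_and_four_dvd_add_of_forall_two_dvd {h : KumIndex → ℤ} {d : ℤ}
    (hh : Matrix.toBilin' (kumGram n) h h = 2 * d) (hh0 : h ≠ 0)
    (hsat : ∀ (k : ℤ) (w : KumIndex → ℤ), k ≠ 0 → k • w ∈ ℤ ∙ h → w ∈ ℤ ∙ h)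
    (h2 : ∀ z, (2 : ℤ) ∣ Matrix.toBilin' (kumGram n) h z) : Odd (h (inr ())) ∧ (4 : ℤ) ∣ d + (n + 1 : ℕ) := by
  obtain ⟨ψ, hψ⟩ := exists_isometryEquiv_toBilin'_kumGram n
  have h0 : ψ h ≠ 0 := fun h1 ↦ hh0 (ψ.toLinearEquiv.map_eq_zero_iff.1 h1)
  have h1 := odd_snd_and_four_dvd_add_of_forall_two_dvd (n + 1) (isUnimodular_hyperbolicSum 3) (isEven_hyperbolicSum 3)
    (r := ψ h) (d := d) (by rw [ψ.map_app, hh]) h0 (forall_mem_span_singleton_apply_of_isometryEquiv ψ hsat)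
    ((forall_dvd_apply_iff_of_isometryEquiv ψ h 2).2 h2)
  rwa [(hψ h).2.2] at h1

/-- **Example 4.10 in `Λ_n`, existence: if `d + (n + 1) = 4b` then there is a primitive `h ∈ Λ_n` with `h² = 2d`,
`(h, f') = 2`, all products even and `ξ`-coordinate `1`** (`h = 2(e + bf) + ξ`, "we may take `c = 1`").
[cite: GritsenkoHulekSankaran2010Symplectic, §4 Example 4.10 and Remark 4.15] -/
theorem kum_exists_apply_self_eq_two_mul_and_forall_two_dvd_of_four_dvd (n : ℕ) {d b : ℤ}
    (hb : d + (n + 1 : ℕ) = 4 * b) :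
    ∃ h h' : KumIndex → ℤ, h (inr ()) = 1 ∧ Matrix.toBilin' (kumGram n) h h = 2 * d ∧
      Matrix.toBilin' (kumGram n) h h' = 2 ∧ (∀ z, (2 : ℤ) ∣ Matrix.toBilin' (kumGram n) h z) ∧
        ∀ (k : ℤ) (w : KumIndex → ℤ), k ≠ 0 → k • w ∈ ℤ ∙ h → w ∈ ℤ ∙ h := by
  obtain ⟨ψ, hψ⟩ := exists_isometryEquiv_toBilin'_kumGram n
  have hP := twoHyperbolicPairs_hyperbolicSum (show (1 : Fin 3) ≠ 0 by decide)
  obtain ⟨r, r', hr1, hr, hr', h2r, hrsat⟩ :=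
    exists_apply_self_eq_two_mul_and_forall_two_dvd_of_four_dvd (n + 1) hP (d := d) (b := b) hb
  have hψr : ψ (ψ.symm r) = r := ψ.toLinearEquiv.apply_symm_apply r
  refine ⟨ψ.symm r, ψ.symm r', ?_, by rw [ψ.symm.map_app, hr], by rw [ψ.symm.map_app, hr'],
    (forall_dvd_apply_iff_of_isometryEquiv ψ.symm r 2).2 h2r, forall_mem_span_singleton_apply_of_isometryEquiv ψ.symm hrsat⟩
  have h3 := (hψ (ψ.symm r)).2.2
  rw [hψr] at h3
  rw [← hr1, h3]

/-- **Example 4.10 in `Λ_n`, the orbit: "the `Õ(L_{2t})`-orbit of `h_d` is unique because `D(L_{2t})` is cyclic"** — two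
primitive vectors of `Λ_n` of the same square `2d` with `(h, Λ_n) = 2ℤ` lie in one `Õ(Λ_n)`-orbit.
[cite: GritsenkoHulekSankaran2010Symplectic, §4 Example 4.10 and Remark 4.15] -/
theorem kum_exists_stable_isometryEquiv_apply_eq_of_forall_two_dvd_of_primitive
    {u v u' v' : KumIndex → ℤ} {d : ℤ} (huu : Matrix.toBilin' (kumGram n) u u = 2 * d)
    (hvv : Matrix.toBilin' (kumGram n) v v = 2 * d) (hu0 : u ≠ 0)
    (husat : ∀ (k : ℤ) (w : KumIndex → ℤ), k ≠ 0 → k • w ∈ ℤ ∙ u → w ∈ ℤ ∙ u) (hv0 : v ≠ 0)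
    (hvsat : ∀ (k : ℤ) (w : KumIndex → ℤ), k ≠ 0 → k • w ∈ ℤ ∙ v → w ∈ ℤ ∙ v)
    (h2u : ∀ z, (2 : ℤ) ∣ Matrix.toBilin' (kumGram n) u z) (h2v : ∀ z, (2 : ℤ) ∣ Matrix.toBilin' (kumGram n) v z)
    (hu' : Matrix.toBilin' (kumGram n) u u' = 2) (hv' : Matrix.toBilin' (kumGram n) v v' = 2) :
    ∃ g : (Matrix.toBilin' (kumGram n)).IsometryEquiv (Matrix.toBilin' (kumGram n)),
      g.discriminantGroupCongr = LinearEquiv.refl ℤ _ ∧ g u = v := by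
  obtain ⟨ψ, -⟩ := exists_isometryEquiv_toBilin'_kumGram n
  have hP := twoHyperbolicPairs_hyperbolicSum (show (1 : Fin 3) ≠ 0 by decide)
  have hu0' : ψ u ≠ 0 := fun h1 ↦ hu0 (ψ.toLinearEquiv.map_eq_zero_iff.1 h1)
  have hv0' : ψ v ≠ 0 := fun h1 ↦ hv0 (ψ.toLinearEquiv.map_eq_zero_iff.1 h1)
  obtain ⟨g₀, hg₀, hg₀u⟩ := exists_stable_isometryEquiv_apply_eq_of_forall_two_dvd_of_primitive (n + 1)
    (isUnimodular_hyperbolicSum 3) (isEven_hyperbolicSum 3) (Nat.succ_pos n) hP (u := ψ u) (v := ψ v) (u' := ψ u')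
    (v' := ψ v') (d := d) (by rw [ψ.map_app, huu]) (by rw [ψ.map_app, hvv]) hu0'
    (forall_mem_span_singleton_apply_of_isometryEquiv ψ husat) hv0' (forall_mem_span_singleton_apply_of_isometryEquiv ψ hvsat)
    ((forall_dvd_apply_iff_of_isometryEquiv ψ u 2).2 h2u) ((forall_dvd_apply_iff_of_isometryEquiv ψ v 2).2 h2v)
    (by rw [ψ.map_app, hu']) (by rw [ψ.map_app, hv'])
  refine ⟨ψ.trans (g₀.trans ψ.symm), discriminantGroupCongr_trans_trans_symm_eq_refl ψ hg₀, ?_⟩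
  rw [LinearMap.BilinForm.IsometryEquiv.trans_apply, LinearMap.BilinForm.IsometryEquiv.trans_apply, hg₀u]
  exact ψ.toLinearEquiv.symm_apply_apply v

/-- **Example 4.10 in `Λ_n` as a count: the primitive vectors of square `2d` with `(h, Λ_n) = 2ℤ` form ONE `Õ(Λ_n)`-orbit if
`d + (n + 1) ≡ 0 (mod 4)` and do not exist otherwise.** [cite: GritsenkoHulekSankaran2010Symplectic, §4 Example 4.10 and Remark 4.15] -/
theorem kum_natCard_quot_stable_isometryEquiv_of_forall_two_dvd_of_primitive (n : ℕ) (d : ℤ) :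
    Nat.card (Quot fun r s : {r : KumIndex → ℤ // Matrix.toBilin' (kumGram n) r r = 2 * d ∧ r ≠ 0 ∧
        (∀ (k : ℤ) (w : KumIndex → ℤ), k ≠ 0 → k • w ∈ ℤ ∙ r → w ∈ ℤ ∙ r) ∧
        (∀ z, (2 : ℤ) ∣ Matrix.toBilin' (kumGram n) r z) ∧ ∃ r', Matrix.toBilin' (kumGram n) r r' = 2} ↦
      ∃ g : (Matrix.toBilin' (kumGram n)).IsometryEquiv (Matrix.toBilin' (kumGram n)),
        g.discriminantGroupCongr = LinearEquiv.refl ℤ _ ∧ g r.1 = s.1) = if (4 : ℤ) ∣ d + (n + 1 : ℕ) then 1 else 0 := by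
  obtain ⟨ψ, -⟩ := exists_isometryEquiv_toBilin'_kumGram n
  have hP := twoHyperbolicPairs_hyperbolicSum (show (1 : Fin 3) ≠ 0 by decide)
  rw [natCard_quot_stable_isometryEquiv_eq_of_isometryEquiv ψ _
    (fun r ↦ (hyperbolicSum 3).prod ((-(2 * (n + 1 : ℕ) : ℤ)) • LinearMap.mul ℤ ℤ) r r = 2 * d ∧ r ≠ 0 ∧
      (∀ (k : ℤ) (w : ((Fin 3 → ℤ) × (Fin 3 → ℤ)) × ℤ), k ≠ 0 → k • w ∈ ℤ ∙ r → w ∈ ℤ ∙ r) ∧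
      (∀ z, (2 : ℤ) ∣ (hyperbolicSum 3).prod ((-(2 * (n + 1 : ℕ) : ℤ)) • LinearMap.mul ℤ ℤ) r z) ∧
      ∃ r', (hyperbolicSum 3).prod ((-(2 * (n + 1 : ℕ) : ℤ)) • LinearMap.mul ℤ ℤ) r r' = 2)
    (fun r ↦ ?_)]
  · exact natCard_quot_stable_isometryEquiv_two_mul_of_forall_two_dvd_of_primitive (n + 1) (isUnimodular_hyperbolicSum 3)
      (isEven_hyperbolicSum 3) (Nat.succ_pos n) hP d
  · have hr0 : r ≠ 0 ↔ ψ r ≠ 0 := ψ.toLinearEquiv.map_ne_zero_iff.symm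
    have hsat : (∀ (k : ℤ) (w : KumIndex → ℤ), k ≠ 0 → k • w ∈ ℤ ∙ r → w ∈ ℤ ∙ r) ↔
        ∀ (k : ℤ) (w : ((Fin 3 → ℤ) × (Fin 3 → ℤ)) × ℤ), k ≠ 0 → k • w ∈ ℤ ∙ ψ r → w ∈ ℤ ∙ ψ r := by
      refine ⟨forall_mem_span_singleton_apply_of_isometryEquiv ψ, fun hs ↦ ?_⟩
      have h1 := forall_mem_span_singleton_apply_of_isometryEquiv ψ.symm hs
      rwa [show ψ.symm (ψ r) = r from ψ.toLinearEquiv.symm_apply_apply r] at h1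
    rw [ψ.map_app, hr0, hsat, forall_dvd_apply_iff_of_isometryEquiv ψ r 2, exists_apply_eq_iff_of_isometryEquiv ψ r 2]

/-- **Example 4.10 in `Λ_n`, the complement: `h^⊥ ≅ 2U ⊕ (−2b t ∕ t −2t)`, `4b = d + t`, `t = n + 1`**, for every primitive
`h ∈ Λ_n` with `h² = 2d` and `(h, Λ_n) = 2ℤ`. [cite: GritsenkoHulekSankaran2010Symplectic, §4 Example 4.10, Prop. 4.6 (iv) and Remark 4.15] -/
theorem kum_restrict_orthogonal_equivalent_of_forall_two_dvd_of_primitive {h : KumIndex → ℤ}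
    {d b : ℤ} (hb : d + (n + 1 : ℕ) = 4 * b) (hh : Matrix.toBilin' (kumGram n) h h = 2 * d) (hh0 : h ≠ 0)
    (hsat : ∀ (k : ℤ) (w : KumIndex → ℤ), k ≠ 0 → k • w ∈ ℤ ∙ h → w ∈ ℤ ∙ h)
    (h2 : ∀ z, (2 : ℤ) ∣ Matrix.toBilin' (kumGram n) h z) (hh' : ∃ h', Matrix.toBilin' (kumGram n) h h' = 2) :
    ((Matrix.toBilin' (kumGram n)).restrict ((Matrix.toBilin' (kumGram n)).orthogonal (ℤ ∙ h))).Equivalent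
      ((hyperbolicSum 2).prod
        (Matrix.toBilin' !![-(2 * b), ((n + 1 : ℕ) : ℤ); ((n + 1 : ℕ) : ℤ), -(2 * (n + 1 : ℕ) : ℤ)])) := by
  obtain ⟨φ⟩ := toBilin'_kumGram_equivalent_model n
  have h0 : φ h ≠ 0 := fun h1 ↦ hh0 (φ.toLinearEquiv.map_eq_zero_iff.1 h1)
  exact ((restrict_orthogonal_equivalent_of_isometryEquiv φ h).trans
    (restrict_orthogonal_model_equivalent_of_forall_two_dvd_of_primitive 0 1 (n + 1) (Nat.succ_pos n) hb (r := φ h)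
      (by rw [φ.map_app, hh]) h0 (forall_mem_span_singleton_apply_of_isometryEquiv φ hsat)
      ((forall_dvd_apply_iff_of_isometryEquiv φ h 2).2 h2) ((exists_apply_eq_iff_of_isometryEquiv φ h 2).2 hh'))).trans
    ((pi_finZero_prod_equivalent _).prod (Equivalent.refl _))

/-- **`|O(q_{Λ_n})| = 2^{ρ(n+1)}`** (`ρ` = number of prime divisors): `(D(Λ_n), q) ≅ (D(⟨−2(n+1)⟩), q)` as `3U` is unimodular,
and GHS 2007 Lemma 4.3. This is the order `2^{ρ(t)}` in Prop. 4.12 (ii), `t = n + 1`.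
[cite: GritsenkoHulekSankaran2007HM, §4 Lemma 4.3] [cite: GritsenkoHulekSankaran2010Symplectic, §4 Prop. 4.12 (ii) and Remark 4.15] -/
theorem natCard_discriminantIsometry_toBilin'_kumGram (n : ℕ)
    (h₁ : (Matrix.toBilin' (kumGram n)).Nondegenerate) (h₂ : (Matrix.toBilin' (kumGram n)).IsSymm)
    (h₃ : (Matrix.toBilin' (kumGram n)).IsEven) :
    Nat.card {σ : (Matrix.toBilin' (kumGram n)).discriminantGroup ≃ₗ[ℤ] (Matrix.toBilin' (kumGram n)).discriminantGroup //
        ∀ a, (Matrix.toBilin' (kumGram n)).discriminantQuad h₁ h₂ h₃ (σ a) =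
          (Matrix.toBilin' (kumGram n)).discriminantQuad h₁ h₂ h₃ a} = 2 ^ (n + 1).primeFactors.card := by
  obtain ⟨ψ, -⟩ := exists_isometryEquiv_toBilin'_kumGram n
  obtain ⟨hR, hsR, heR⟩ := nondegenerate_isSymm_isEven_neg_twoMul_smul_mul (n + 1) (Nat.succ_pos n)
  have h₁' : ((hyperbolicSum 3).prod ((-(2 * (n + 1 : ℕ) : ℤ)) • LinearMap.mul ℤ ℤ)).Nondegenerate :=
    (isUnimodular_hyperbolicSum 3).nondegenerate.prod hR
  have h₂' : ((hyperbolicSum 3).prod ((-(2 * (n + 1 : ℕ) : ℤ)) • LinearMap.mul ℤ ℤ)).IsSymm :=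
    (isSymm_hyperbolicSum 3).prod hsR
  have h₃' : ((hyperbolicSum 3).prod ((-(2 * (n + 1 : ℕ) : ℤ)) • LinearMap.mul ℤ ℤ)).IsEven :=
    isEven_prod_iff.2 ⟨isEven_hyperbolicSum 3, heR⟩
  rw [natCard_discriminantIsometry_eq_of_isometryEquiv _ _ ψ h₁ h₂ h₃ h₁' h₂' h₃']
  exact natCard_discriminantIsometry_prod_neg_twoMul_smul_mul_of_isUnimodular _ (isSymm_hyperbolicSum 3)
    (isUnimodular_hyperbolicSum 3) (isEven_hyperbolicSum 3) (Nat.succ_pos n) h₁' h₂' h₃'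

/-- **Prop. 4.12 (ii) for `f = 1` in `Λ_n`: `|O(Λ_n, h)/Õ(Λ_n, h)| = 2^{ρ(n+1)}` for EVERY split `h`** (`h² = 2d ≠ 0`,
`(h, h') = 1`): the restrictions to `h^⊥` of the isometries of `Λ_n` fixing `h`, modulo those inducing the same automorphism
of `D(h^⊥)` (i.e. modulo `Õ(h^⊥) ≅ Õ(Λ_n, h)`, Prop. 4.12 (i)), number `2^{ρ(t)}`, `t = n + 1` ("The factor group
`O(L_{2t}, h_d)/Õ(L_{2t}, h_d)` is an abelian `2`-group, which is of order `2^{ρ(t/f)}` if `f` is odd"; no group structure is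
declared here, so "abelian `2`-group" is not stated). [cite: GritsenkoHulekSankaran2010Symplectic, §4 Prop. 4.12 (ii), Example 4.8 and Remark 4.15] [cite: GritsenkoHulekSankaran2007HM, §4 Lemma 4.3] -/
theorem kum_natCard_quot_exists_isometryEquiv_apply_eq_of_apply_eq_one {d : ℤ} (hd : d ≠ 0)
    {u u' : KumIndex → ℤ} (hu : Matrix.toBilin' (kumGram n) u u = 2 * d) (hu' : Matrix.toBilin' (kumGram n) u u' = 1) :
    Nat.card (Quot fun γ γ' : {γ : ((Matrix.toBilin' (kumGram n)).restrict
          ((Matrix.toBilin' (kumGram n)).orthogonal (ℤ ∙ u))).IsometryEquiv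
          ((Matrix.toBilin' (kumGram n)).restrict ((Matrix.toBilin' (kumGram n)).orthogonal (ℤ ∙ u))) //
        ∃ G : (Matrix.toBilin' (kumGram n)).IsometryEquiv (Matrix.toBilin' (kumGram n)),
          G u = u ∧ ∀ m : (Matrix.toBilin' (kumGram n)).orthogonal (ℤ ∙ u), G m = γ m} ↦
        γ.1.discriminantGroupCongr = γ'.1.discriminantGroupCongr) = 2 ^ (n + 1).primeFactors.card := by
  obtain ⟨φ⟩ := toBilin'_kumGram_equivalent_model n
  obtain ⟨hs, he, huB⟩ := isSymm_isEven_isUnimodular_pi_neg_e8Form_prod_hyperbolicSum' 0 3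
  obtain ⟨-, hsR, heR⟩ := nondegenerate_isSymm_isEven_neg_twoMul_smul_mul (n + 1) (Nat.succ_pos n)
  rw [natCard_quot_exists_isometryEquiv_apply_eq_eq_of_isometryEquiv φ u]
  exact natCard_quot_exists_isometryEquiv_apply_eq_model_of_apply_eq_one 0 1 (t := n + 1) (Nat.succ_pos n) hd
    (nondegenerate_prod_neg_twoMul_smul_mul _ (n + 1) huB (Nat.succ_pos n)) (hs.prod hsR) (isEven_prod_iff.2 ⟨he, heR⟩)
    (u := φ u) (u' := φ u') (by rw [φ.map_app, hu]) (by rw [φ.map_app, hu'])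

end PolarisationTypes

/-! ### §4 Prop. 4.6 for a general divisor `f` in `Λ_n` -/

section GeneralDivisor

variable {n : ℕ}

/-- **"The coefficient `c` is coprime to `f` because `h_d` is primitive"** in `Λ_n`: for a primitive `h ∈ Λ_n` with
`f ∣ (h, z)` for all `z`, the `ξ`-coordinate `h_ξ` is coprime to `f` (`h = fv + h_ξ ξ`).
[cite: GritsenkoHulekSankaran2010Symplectic, §4 proof of Prop. 4.6 and Remark 4.15] -/
theorem kum_gcd_eq_one_of_primitive_of_forall_dvd {h : KumIndex → ℤ} {f : ℤ} (hh0 : h ≠ 0)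
    (hsat : ∀ (k : ℤ) (w : KumIndex → ℤ), k ≠ 0 → k • w ∈ ℤ ∙ h → w ∈ ℤ ∙ h)
    (hf : ∀ z, f ∣ Matrix.toBilin' (kumGram n) h z) : Int.gcd f (h (inr ())) = 1 := by
  obtain ⟨ψ, hψ⟩ := exists_isometryEquiv_toBilin'_kumGram n
  have h0 : ψ h ≠ 0 := fun h1 ↦ hh0 (ψ.toLinearEquiv.map_eq_zero_iff.1 h1)
  have h1 := gcd_snd_eq_one_of_primitive_of_forall_dvd (n + 1) (isUnimodular_hyperbolicSum 3) h0
    (forall_mem_span_singleton_apply_of_isometryEquiv ψ hsat) ((forall_dvd_apply_iff_of_isometryEquiv ψ h f).2 hf)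
  rwa [(hψ h).2.2] at h1

/-- **"`2d = 2bf² − 2c²t`" in `Λ_n`: `f² ∣ d + (n+1)h_ξ²`** for `h ∈ Λ_n` with `h² = 2d` and `f ∣ (h, z)` for all `z`.
[cite: GritsenkoHulekSankaran2010Symplectic, §4 proof of Prop. 4.6 (display (c-eq)) and Remark 4.15] -/
theorem kum_sq_dvd_add_mul_sq_of_forall_dvd {h : KumIndex → ℤ} {f d : ℤ}
    (hh : Matrix.toBilin' (kumGram n) h h = 2 * d) (hf : ∀ z, f ∣ Matrix.toBilin' (kumGram n) h z) :
    f ^ 2 ∣ d + (n + 1 : ℕ) * h (inr ()) ^ 2 := by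
  obtain ⟨ψ, hψ⟩ := exists_isometryEquiv_toBilin'_kumGram n
  have h1 := sq_dvd_add_mul_snd_sq_of_forall_dvd (n + 1) (isUnimodular_hyperbolicSum 3) (isEven_hyperbolicSum 3) (r := ψ h)
    (by rw [ψ.map_app, hh]) ((forall_dvd_apply_iff_of_isometryEquiv ψ h f).2 hf)
  rwa [(hψ h).2.2] at h1

/-- **Prop. 4.6, the count, in `Λ_n`**: for `f ≥ 1`, `f ∣ 2(n+1)`, the `Õ(Λ_n)`-orbits of primitive `h ∈ Λ_n` with `h² = 2d`
and `(h, Λ_n) = fℤ` are in bijection (via `h_ξ mod f`) with `{c mod f : (c, f) = 1, f² ∣ d + (n+1)c²}` ("the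
`Õ(L_{2t})`-orbit of `h_d` is … determined by `c mod f`"; their number is evaluated in Prop. 4.6 (i)–(iii)).
[cite: GritsenkoHulekSankaran2010Symplectic, §4 Prop. 4.6 and proof, first paragraph, and Remark 4.15] -/
theorem kum_natCard_quot_stable_isometryEquiv_of_divisor (n : ℕ) (d : ℤ) {f : ℕ} (hf0 : 0 < f)
    (hf : (f : ℤ) ∣ 2 * (n + 1 : ℕ)) :
    Nat.card (Quot fun r s : {r : KumIndex → ℤ // Matrix.toBilin' (kumGram n) r r = 2 * d ∧ r ≠ 0 ∧
        (∀ (k : ℤ) (w : KumIndex → ℤ), k ≠ 0 → k • w ∈ ℤ ∙ r → w ∈ ℤ ∙ r) ∧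
        (∀ z, (f : ℤ) ∣ Matrix.toBilin' (kumGram n) r z) ∧ ∃ r', Matrix.toBilin' (kumGram n) r r' = f} ↦
      ∃ g : (Matrix.toBilin' (kumGram n)).IsometryEquiv (Matrix.toBilin' (kumGram n)),
        g.discriminantGroupCongr = LinearEquiv.refl ℤ _ ∧ g r.1 = s.1) =
      Nat.card {c : ZMod f // IsUnit c ∧ (f : ℤ) ^ 2 ∣ d + (n + 1 : ℕ) * (c.val : ℤ) ^ 2} := by
  obtain ⟨ψ, -⟩ := exists_isometryEquiv_toBilin'_kumGram n
  have hP := twoHyperbolicPairs_hyperbolicSum (show (1 : Fin 3) ≠ 0 by decide)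
  rw [natCard_quot_stable_isometryEquiv_eq_of_isometryEquiv ψ _
    (fun r ↦ (hyperbolicSum 3).prod ((-(2 * (n + 1 : ℕ) : ℤ)) • LinearMap.mul ℤ ℤ) r r = 2 * d ∧ r ≠ 0 ∧
      (∀ (k : ℤ) (w : ((Fin 3 → ℤ) × (Fin 3 → ℤ)) × ℤ), k ≠ 0 → k • w ∈ ℤ ∙ r → w ∈ ℤ ∙ r) ∧
      (∀ z, (f : ℤ) ∣ (hyperbolicSum 3).prod ((-(2 * (n + 1 : ℕ) : ℤ)) • LinearMap.mul ℤ ℤ) r z) ∧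
      ∃ r', (hyperbolicSum 3).prod ((-(2 * (n + 1 : ℕ) : ℤ)) • LinearMap.mul ℤ ℤ) r r' = f)
    (fun r ↦ ?_)]
  · exact natCard_quot_stable_isometryEquiv_two_mul_of_divisor (n + 1) (isUnimodular_hyperbolicSum 3)
      (isEven_hyperbolicSum 3) (Nat.succ_pos n) hP d hf0 hf
  · have hr0 : r ≠ 0 ↔ ψ r ≠ 0 := ψ.toLinearEquiv.map_ne_zero_iff.symm
    have hsat : (∀ (k : ℤ) (w : KumIndex → ℤ), k ≠ 0 → k • w ∈ ℤ ∙ r → w ∈ ℤ ∙ r) ↔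
        ∀ (k : ℤ) (w : ((Fin 3 → ℤ) × (Fin 3 → ℤ)) × ℤ), k ≠ 0 → k • w ∈ ℤ ∙ ψ r → w ∈ ℤ ∙ ψ r := by
      refine ⟨forall_mem_span_singleton_apply_of_isometryEquiv ψ, fun hs ↦ ?_⟩
      have h1 := forall_mem_span_singleton_apply_of_isometryEquiv ψ.symm hs
      rwa [show ψ.symm (ψ r) = r from ψ.toLinearEquiv.symm_apply_apply r] at h1
    rw [ψ.map_app, hr0, hsat, forall_dvd_apply_iff_of_isometryEquiv ψ r f, exists_apply_eq_iff_of_isometryEquiv ψ r f]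

/-- **Prop. 4.6 (iv) in `Λ_n`: `h^⊥ ≅ 2U ⊕ B`, `B = (−2b a ∕ a −2(n+1))`** for EVERY primitive `h ∈ Λ_n` with `h² = 2d`,
`(h, Λ_n) = fℤ` (`f ≠ 0`), where `c = h_ξ`, `f²b = d + (n+1)c²` and `fa = 2(n+1)c` (`a = c·2t/f`, `t = n + 1`).
[cite: GritsenkoHulekSankaran2010Symplectic, §4 Prop. 4.6 (iv) and Remark 4.15] -/
theorem kum_restrict_orthogonal_equivalent_of_divisor {h : KumIndex → ℤ} {f d b a : ℤ}
    (hf : f ≠ 0) (hh : Matrix.toBilin' (kumGram n) h h = 2 * d)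
    (hfh : ∀ z, f ∣ Matrix.toBilin' (kumGram n) h z) (hh' : ∃ h', Matrix.toBilin' (kumGram n) h h' = f)
    (hb : f ^ 2 * b = d + (n + 1 : ℕ) * h (inr ()) ^ 2) (ha : f * a = 2 * (n + 1 : ℕ) * h (inr ())) :
    ((Matrix.toBilin' (kumGram n)).restrict ((Matrix.toBilin' (kumGram n)).orthogonal (ℤ ∙ h))).Equivalent
      ((hyperbolicSum 2).prod (Matrix.toBilin' !![-(2 * b), a; a, -(2 * (n + 1 : ℕ) : ℤ)])) := by
  obtain ⟨φ, hφ⟩ := exists_isometryEquiv_toBilin'_kumGram_model n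
  rw [← hφ h] at hb ha
  exact ((restrict_orthogonal_equivalent_of_isometryEquiv φ h).trans
    (restrict_orthogonal_model_equivalent_of_divisor 0 1 (n + 1) (Nat.succ_pos n) hf (r := φ h) (by rw [φ.map_app, hh])
      ((forall_dvd_apply_iff_of_isometryEquiv φ h f).2 hfh) ((exists_apply_eq_iff_of_isometryEquiv φ h f).2 hh') hb ha)).trans
    ((pi_finZero_prod_equivalent _).prod (Equivalent.refl _))

end GeneralDivisor

/-! ### §5 Kummer fourfolds: `n = 2`, `t = 3`, `Λ_2 = 3U ⊕ ⟨−6⟩` (row g43-#10)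

For `n = 2` (the generalized Kummer FOURFOLDS and their deformations) `t = n + 1 = 3`, `A_{Λ_2} ≅ ℤ/6`, and the divisor
`f = div(h)` of a primitive `h` runs through `1, 2, 3, 6`. Prop. 4.6 ("the number of `Õ(L_{2t})`-orbits … is determined by
`c mod f`", with `f²b = d + tc²`, `(c, f) = 1`) is evaluated: for `f = 3` the admissible classes are `c = ±1 mod 3` iff
`9 ∣ d + 3`, for `f = 6` they are `c = ±1 mod 6` iff `36 ∣ d + 3`. -/

section KummerFour

/-- `|A_{Λ_2}| = 6` for the Kummer-fourfold lattice `Λ_2 = 3U ⊕ ⟨−6⟩` ("cyclic of order `dim Y + 2`", `dim Y = 4`).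
[cite: Markman2023GeneralizedKummers, §1.1 p. 234] -/
theorem natCard_discriminantGroup_toBilin'_kumGram_two :
    Nat.card (Matrix.toBilin' (kumGram 2)).discriminantGroup = 6 :=
  natCard_discriminantGroup_toBilin'_kumGram 2

/-- **`n = 2`: `div(h) ∣ 6`** for every primitive `h ∈ Λ_2` ("`div(h_d)` is a common divisor of `2d` and `2t`", `2t = 6`).
[cite: GritsenkoHulekSankaran2010Symplectic, §4 (before Prop. 4.6) and Remark 4.15] -/
theorem kumTwo_dvd_six_of_forall_dvd_of_primitive {h : KumIndex → ℤ} {δ : ℤ} (hh0 : h ≠ 0)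
    (hsat : ∀ (k : ℤ) (w : KumIndex → ℤ), k ≠ 0 → k • w ∈ ℤ ∙ h → w ∈ ℤ ∙ h)
    (hδ : ∀ z, δ ∣ Matrix.toBilin' (kumGram 2) h z) : δ ∣ 6 := by
  simpa using kum_dvd_two_mul_of_forall_dvd_of_primitive hh0 hsat hδ

/-- **`n = 2`, Example 4.11: if `3 ∤ d` then a primitive `h ∈ Λ_2` of square `2d` is split or has `(h, Λ_2) = 2ℤ`**
("if `(t, d) = 1`, then `f = div(h_d)` is equal to `1` or `2`", `t = 3`). [cite: GritsenkoHulekSankaran2010Symplectic, §4 Example 4.11 and Remark 4.15] -/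
theorem kumTwo_exists_apply_eq_one_or_forall_two_dvd_of_not_three_dvd {h : KumIndex → ℤ} {d : ℤ}
    (hh : Matrix.toBilin' (kumGram 2) h h = 2 * d) (hh0 : h ≠ 0)
    (hsat : ∀ (k : ℤ) (w : KumIndex → ℤ), k ≠ 0 → k • w ∈ ℤ ∙ h → w ∈ ℤ ∙ h) (h3 : ¬ (3 : ℤ) ∣ d) :
    (∃ h', Matrix.toBilin' (kumGram 2) h h' = 1) ∨
      ((∀ z, (2 : ℤ) ∣ Matrix.toBilin' (kumGram 2) h z) ∧ ∃ h', Matrix.toBilin' (kumGram 2) h h' = 2) :=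
  kum_exists_apply_eq_one_or_forall_two_dvd_of_gcd_eq_one hh hh0 hsat (by
    rw [← Int.isCoprime_iff_gcd_eq_one]
    exact (Int.prime_three.coprime_iff_not_dvd).2 h3)

/-- **`n = 2`, Example 4.10 evaluated: the non-split vectors of square `2d` with `(h, Λ_2) = 2ℤ` form ONE `Õ(Λ_2)`-orbit if
`d ≡ 1 (mod 4)` and do not exist otherwise** (`d + t ≡ 0 mod 4`, `t = 3`). [cite: GritsenkoHulekSankaran2010Symplectic, §4 Example 4.10 and Remark 4.15] -/
theorem kumTwo_natCard_quot_stable_isometryEquiv_of_forall_two_dvd_of_primitive (d : ℤ) :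
    Nat.card (Quot fun r s : {r : KumIndex → ℤ // Matrix.toBilin' (kumGram 2) r r = 2 * d ∧ r ≠ 0 ∧
        (∀ (k : ℤ) (w : KumIndex → ℤ), k ≠ 0 → k • w ∈ ℤ ∙ r → w ∈ ℤ ∙ r) ∧
        (∀ z, (2 : ℤ) ∣ Matrix.toBilin' (kumGram 2) r z) ∧ ∃ r', Matrix.toBilin' (kumGram 2) r r' = 2} ↦
      ∃ g : (Matrix.toBilin' (kumGram 2)).IsometryEquiv (Matrix.toBilin' (kumGram 2)),
        g.discriminantGroupCongr = LinearEquiv.refl ℤ _ ∧ g r.1 = s.1) = if (4 : ℤ) ∣ d + 3 then 1 else 0 := by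
  have h := kum_natCard_quot_stable_isometryEquiv_of_forall_two_dvd_of_primitive 2 d
  norm_num at h
  exact h

/-- `f = 3`, `t = 3`: the classes `c mod 3` with `(c, 3) = 1` and `9 ∣ d + 3c²` are `c = ±1` if `9 ∣ d + 3` and none
otherwise (`c² ≡ 1 mod 3`). [cite: GritsenkoHulekSankaran2010Symplectic, §4 proof of Prop. 4.6 (displays (c1-cong0), (c1-cong1-1))] -/
private theorem natCard_units_zmod_three_sq_dvd (d : ℤ) :
    Nat.card {c : ZMod 3 // IsUnit c ∧ ((3 : ℕ) : ℤ) ^ 2 ∣ d + (2 + 1 : ℕ) * (c.val : ℤ) ^ 2} =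
      if (9 : ℤ) ∣ d + 3 then 2 else 0 := by
  have key : ∀ c : ZMod 3, (IsUnit c ∧ ((3 : ℕ) : ℤ) ^ 2 ∣ d + (2 + 1 : ℕ) * (c.val : ℤ) ^ 2) ↔
      (¬ c.val = 0 ∧ (9 : ℤ) ∣ d + 3) := by
    intro c
    rw [isUnit_iff_ne_zero, ne_eq, ← ZMod.val_eq_zero]
    have hv : c.val < 3 := c.val_lt
    rcases (show c.val = 0 ∨ c.val = 1 ∨ c.val = 2 by omega) with h | h | h
    · simp [h]
    · rw [h]; norm_num
    · rw [h]; norm_num; omega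
  rw [Nat.card_congr (Equiv.subtypeEquivRight key)]
  by_cases h9 : (9 : ℤ) ∣ d + 3
  · simp only [h9, and_true, Nat.card_eq_fintype_card]
    rw [if_pos trivial]
    decide
  · simp only [h9, and_false, if_false]
    simp

/-- `f = 6`, `t = 3`: the classes `c mod 6` with `(c, 6) = 1` and `36 ∣ d + 3c²` are `c = ±1` if `36 ∣ d + 3` and none
otherwise (`c² ≡ 1 mod 24` for `(c, 6) = 1`). [cite: GritsenkoHulekSankaran2010Symplectic, §4 proof of Prop. 4.6 (displays (c1-cong0), (c1-cong1-1))] -/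
private theorem natCard_units_zmod_six_sq_dvd (d : ℤ) :
    Nat.card {c : ZMod 6 // IsUnit c ∧ ((6 : ℕ) : ℤ) ^ 2 ∣ d + (2 + 1 : ℕ) * (c.val : ℤ) ^ 2} =
      if (36 : ℤ) ∣ d + 3 then 2 else 0 := by
  have key : ∀ c : ZMod 6, (IsUnit c ∧ ((6 : ℕ) : ℤ) ^ 2 ∣ d + (2 + 1 : ℕ) * (c.val : ℤ) ^ 2) ↔
      ((c.val = 1 ∨ c.val = 5) ∧ (36 : ℤ) ∣ d + 3) := by
    intro c
    have hu : IsUnit c ↔ c.val.Coprime 6 := by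
      conv_lhs => rw [← ZMod.natCast_zmod_val c]
      exact ZMod.isUnit_iff_coprime _ _
    rw [hu]
    have hv : c.val < 6 := c.val_lt
    rcases (show c.val = 0 ∨ c.val = 1 ∨ c.val = 2 ∨ c.val = 3 ∨ c.val = 4 ∨ c.val = 5 by omega)
      with h | h | h | h | h | h <;> rw [h] <;> norm_num
    omega
  rw [Nat.card_congr (Equiv.subtypeEquivRight key)]
  by_cases h36 : (36 : ℤ) ∣ d + 3
  · simp only [h36, and_true, Nat.card_eq_fintype_card]
    rw [if_pos trivial]
    decide
  · simp only [h36, and_false, if_false]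
    simp

/-- **`n = 2`, Prop. 4.6 evaluated for `f = 3`: the primitive `h ∈ Λ_2` of square `2d` with `(h, Λ_2) = 3ℤ` form TWO
`Õ(Λ_2)`-orbits (`c = h_ξ ≡ ±1 mod 3`) if `9 ∣ d + 3` and do not exist otherwise** (count `#{c mod f : (c,f) = 1, f²∣d + tc²}`
at `t = f = 3`). [cite: GritsenkoHulekSankaran2010Symplectic, §4 Prop. 4.6 and proof, first paragraph, and Remark 4.15] -/
theorem kumTwo_natCard_quot_stable_isometryEquiv_of_divisor_three (d : ℤ) :
    Nat.card (Quot fun r s : {r : KumIndex → ℤ // Matrix.toBilin' (kumGram 2) r r = 2 * d ∧ r ≠ 0 ∧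
        (∀ (k : ℤ) (w : KumIndex → ℤ), k ≠ 0 → k • w ∈ ℤ ∙ r → w ∈ ℤ ∙ r) ∧
        (∀ z, (3 : ℤ) ∣ Matrix.toBilin' (kumGram 2) r z) ∧ ∃ r', Matrix.toBilin' (kumGram 2) r r' = 3} ↦
      ∃ g : (Matrix.toBilin' (kumGram 2)).IsometryEquiv (Matrix.toBilin' (kumGram 2)),
        g.discriminantGroupCongr = LinearEquiv.refl ℤ _ ∧ g r.1 = s.1) = if (9 : ℤ) ∣ d + 3 then 2 else 0 := by
  have h := kum_natCard_quot_stable_isometryEquiv_of_divisor 2 d (f := 3) three_pos (by norm_num)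
  rw [natCard_units_zmod_three_sq_dvd d] at h
  exact h

/-- **`n = 2`, Prop. 4.6 evaluated for `f = 6`: the primitive `h ∈ Λ_2` of square `2d` with `(h, Λ_2) = 6ℤ` form TWO
`Õ(Λ_2)`-orbits (`h_ξ ≡ ±1 mod 6`) if `36 ∣ d + 3` and do not exist otherwise** (`t = 3`, `f = 2t = 6`).
[cite: GritsenkoHulekSankaran2010Symplectic, §4 Prop. 4.6 and proof, first paragraph, and Remark 4.15] -/
theorem kumTwo_natCard_quot_stable_isometryEquiv_of_divisor_six (d : ℤ) :
    Nat.card (Quot fun r s : {r : KumIndex → ℤ // Matrix.toBilin' (kumGram 2) r r = 2 * d ∧ r ≠ 0 ∧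
        (∀ (k : ℤ) (w : KumIndex → ℤ), k ≠ 0 → k • w ∈ ℤ ∙ r → w ∈ ℤ ∙ r) ∧
        (∀ z, (6 : ℤ) ∣ Matrix.toBilin' (kumGram 2) r z) ∧ ∃ r', Matrix.toBilin' (kumGram 2) r r' = 6} ↦
      ∃ g : (Matrix.toBilin' (kumGram 2)).IsometryEquiv (Matrix.toBilin' (kumGram 2)),
        g.discriminantGroupCongr = LinearEquiv.refl ℤ _ ∧ g r.1 = s.1) = if (36 : ℤ) ∣ d + 3 then 2 else 0 := by
  have h := kum_natCard_quot_stable_isometryEquiv_of_divisor 2 d (f := 6) (by norm_num) (by norm_num)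
  rw [natCard_units_zmod_six_sq_dvd d] at h
  exact h

/-- **`n = 2`, `f = 3`, necessity: a primitive `h ∈ Λ_2` with `h² = 2d` and `3 ∣ (h, z)` for all `z` forces `9 ∣ d + 3`**
(`9 ∣ d + 3c²` with `(c, 3) = 1`, `c = h_ξ`; "`2d = 2bf² − 2c²t`", "`c` is coprime to `f`").
[cite: GritsenkoHulekSankaran2010Symplectic, §4 proof of Prop. 4.6 and Remark 4.15] -/
theorem kumTwo_nine_dvd_of_divisor_three {h : KumIndex → ℤ} {d : ℤ}
    (hh : Matrix.toBilin' (kumGram 2) h h = 2 * d) (hh0 : h ≠ 0)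
    (hsat : ∀ (k : ℤ) (w : KumIndex → ℤ), k ≠ 0 → k • w ∈ ℤ ∙ h → w ∈ ℤ ∙ h)
    (h3 : ∀ z, (3 : ℤ) ∣ Matrix.toBilin' (kumGram 2) h z) : (9 : ℤ) ∣ d + 3 := by
  have hg := kum_gcd_eq_one_of_primitive_of_forall_dvd hh0 hsat h3
  have hsq := kum_sq_dvd_add_mul_sq_of_forall_dvd hh h3
  norm_num at hsq
  have h3c : ¬ (3 : ℤ) ∣ h (inr ()) :=
    (Int.prime_three.coprime_iff_not_dvd).1 (Int.isCoprime_iff_gcd_eq_one.2 hg)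
  have h31 : (3 : ℤ) ∣ h (inr ()) ^ 2 - 1 := by
    rcases (show (3 : ℤ) ∣ h (inr ()) - 1 ∨ (3 : ℤ) ∣ h (inr ()) + 1 by omega) with hd | hd
    · rw [show h (inr ()) ^ 2 - 1 = (h (inr ()) - 1) * (h (inr ()) + 1) by ring]; exact hd.mul_right _
    · rw [show h (inr ()) ^ 2 - 1 = (h (inr ()) - 1) * (h (inr ()) + 1) by ring]; exact hd.mul_left _
  omega

/-- **`n = 2`, `f = 6`, necessity: a primitive `h ∈ Λ_2` with `h² = 2d` and `6 ∣ (h, z)` for all `z` forces `36 ∣ d + 3`**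
(`36 ∣ d + 3c²` with `(c, 6) = 1`, hence `c² ≡ 1 mod 24`). [cite: GritsenkoHulekSankaran2010Symplectic, §4 proof of Prop. 4.6 and Remark 4.15] -/
theorem kumTwo_thirtySix_dvd_of_divisor_six {h : KumIndex → ℤ} {d : ℤ}
    (hh : Matrix.toBilin' (kumGram 2) h h = 2 * d) (hh0 : h ≠ 0)
    (hsat : ∀ (k : ℤ) (w : KumIndex → ℤ), k ≠ 0 → k • w ∈ ℤ ∙ h → w ∈ ℤ ∙ h)
    (h6 : ∀ z, (6 : ℤ) ∣ Matrix.toBilin' (kumGram 2) h z) : (36 : ℤ) ∣ d + 3 := by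
  have hg := kum_gcd_eq_one_of_primitive_of_forall_dvd hh0 hsat h6
  have hsq := kum_sq_dvd_add_mul_sq_of_forall_dvd hh h6
  norm_num at hsq
  have hcop : IsCoprime (2 * 3 : ℤ) (h (inr ())) := by
    rw [show (2 * 3 : ℤ) = 6 by norm_num]; exact Int.isCoprime_iff_gcd_eq_one.2 hg
  have h2c : ¬ (2 : ℤ) ∣ h (inr ()) := (Int.prime_two.coprime_iff_not_dvd).1 hcop.of_mul_left_left
  have h3c : ¬ (3 : ℤ) ∣ h (inr ()) := (Int.prime_three.coprime_iff_not_dvd).1 hcop.of_mul_left_right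
  have h31 : (3 : ℤ) ∣ h (inr ()) ^ 2 - 1 := by
    rcases (show (3 : ℤ) ∣ h (inr ()) - 1 ∨ (3 : ℤ) ∣ h (inr ()) + 1 by omega) with hd | hd
    · rw [show h (inr ()) ^ 2 - 1 = (h (inr ()) - 1) * (h (inr ()) + 1) by ring]; exact hd.mul_right _
    · rw [show h (inr ()) ^ 2 - 1 = (h (inr ()) - 1) * (h (inr ()) + 1) by ring]; exact hd.mul_left _
  have h81 : (8 : ℤ) ∣ h (inr ()) ^ 2 - 1 := by
    have hc := (Int.mod_modEq (h (inr ())) 8).symm.pow 2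
    have hr : h (inr ()) % 8 = 1 ∨ h (inr ()) % 8 = 3 ∨ h (inr ()) % 8 = 5 ∨ h (inr ()) % 8 = 7 := by omega
    have h1 : h (inr ()) ^ 2 ≡ 1 [ZMOD 8] := by
      rcases hr with hr | hr | hr | hr <;> rw [hr] at hc
      · exact hc
      · exact hc.trans (by decide)
      · exact hc.trans (by decide)
      · exact hc.trans (by decide)
    exact Int.ModEq.dvd h1.symm
  omega

/-- **`n = 2`, Prop. 4.6 existence for `f = 3`: a primitive `h ∈ Λ_2` of square `2d` with `(h, Λ_2) = 3ℤ` exists iff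
`9 ∣ d + 3`.** [cite: GritsenkoHulekSankaran2010Symplectic, §4 Prop. 4.6 ("such an `h_d` exists if and only if …") and Remark 4.15] -/
theorem kumTwo_exists_divisor_three_iff (d : ℤ) :
    (∃ h : KumIndex → ℤ, Matrix.toBilin' (kumGram 2) h h = 2 * d ∧ h ≠ 0 ∧
        (∀ (k : ℤ) (w : KumIndex → ℤ), k ≠ 0 → k • w ∈ ℤ ∙ h → w ∈ ℤ ∙ h) ∧
        (∀ z, (3 : ℤ) ∣ Matrix.toBilin' (kumGram 2) h z) ∧ ∃ h', Matrix.toBilin' (kumGram 2) h h' = 3) ↔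
      (9 : ℤ) ∣ d + 3 := by
  refine ⟨fun ⟨h, hh, hh0, hsat, h3, _⟩ ↦ kumTwo_nine_dvd_of_divisor_three hh hh0 hsat h3, fun h9 ↦ ?_⟩
  have hc := kumTwo_natCard_quot_stable_isometryEquiv_of_divisor_three d
  rw [if_pos h9] at hc
  obtain ⟨⟨q⟩, -⟩ := Nat.card_ne_zero.1 (by rw [hc]; norm_num)
  obtain ⟨⟨r, hr⟩, -⟩ := Quot.exists_rep q
  exact ⟨r, hr⟩

/-- **`n = 2`, Prop. 4.6 existence for `f = 6`: a primitive `h ∈ Λ_2` of square `2d` with `(h, Λ_2) = 6ℤ` exists iff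
`36 ∣ d + 3`.** [cite: GritsenkoHulekSankaran2010Symplectic, §4 Prop. 4.6 ("such an `h_d` exists if and only if …") and Remark 4.15] -/
theorem kumTwo_exists_divisor_six_iff (d : ℤ) :
    (∃ h : KumIndex → ℤ, Matrix.toBilin' (kumGram 2) h h = 2 * d ∧ h ≠ 0 ∧
        (∀ (k : ℤ) (w : KumIndex → ℤ), k ≠ 0 → k • w ∈ ℤ ∙ h → w ∈ ℤ ∙ h) ∧
        (∀ z, (6 : ℤ) ∣ Matrix.toBilin' (kumGram 2) h z) ∧ ∃ h', Matrix.toBilin' (kumGram 2) h h' = 6) ↔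
      (36 : ℤ) ∣ d + 3 := by
  refine ⟨fun ⟨h, hh, hh0, hsat, h6, _⟩ ↦ kumTwo_thirtySix_dvd_of_divisor_six hh hh0 hsat h6, fun h36 ↦ ?_⟩
  have hc := kumTwo_natCard_quot_stable_isometryEquiv_of_divisor_six d
  rw [if_pos h36] at hc
  obtain ⟨⟨q⟩, -⟩ := Nat.card_ne_zero.1 (by rw [hc]; norm_num)
  obtain ⟨⟨r, hr⟩, -⟩ := Quot.exists_rep q
  exact ⟨r, hr⟩

/-- **`n = 2`, Prop. 4.6 (iv) for `f = 3`: `h^⊥ ≅ 2U ⊕ (−2b 2c ∕ 2c −6)`**, `c = h_ξ`, `9b = d + 3c²` (`a = c·2t/f = 2c`).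
[cite: GritsenkoHulekSankaran2010Symplectic, §4 Prop. 4.6 (iv) and Remark 4.15] -/
theorem kumTwo_restrict_orthogonal_equivalent_of_divisor_three {h : KumIndex → ℤ} {d b : ℤ}
    (hh : Matrix.toBilin' (kumGram 2) h h = 2 * d)
    (hfh : ∀ z, (3 : ℤ) ∣ Matrix.toBilin' (kumGram 2) h z) (hh' : ∃ h', Matrix.toBilin' (kumGram 2) h h' = 3)
    (hb : 9 * b = d + 3 * h (inr ()) ^ 2) :
    ((Matrix.toBilin' (kumGram 2)).restrict ((Matrix.toBilin' (kumGram 2)).orthogonal (ℤ ∙ h))).Equivalent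
      ((hyperbolicSum 2).prod (Matrix.toBilin' !![-(2 * b), 2 * h (inr ()); 2 * h (inr ()), -6])) := by
  have h1 := kum_restrict_orthogonal_equivalent_of_divisor (n := 2) (f := 3) (a := 2 * h (inr ())) (b := b) (d := d)
    (by norm_num) hh hfh hh' (by push_cast; linarith) (by push_cast; ring)
  norm_num at h1
  exact h1

/-- **`n = 2`, Prop. 4.6 (iv) for `f = 6`: `h^⊥ ≅ 2U ⊕ (−2b c ∕ c −6)`**, `c = h_ξ`, `36b = d + 3c²` (`a = c·2t/f = c`).
[cite: GritsenkoHulekSankaran2010Symplectic, §4 Prop. 4.6 (iv) and Remark 4.15] -/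
theorem kumTwo_restrict_orthogonal_equivalent_of_divisor_six {h : KumIndex → ℤ} {d b : ℤ}
    (hh : Matrix.toBilin' (kumGram 2) h h = 2 * d)
    (hfh : ∀ z, (6 : ℤ) ∣ Matrix.toBilin' (kumGram 2) h z) (hh' : ∃ h', Matrix.toBilin' (kumGram 2) h h' = 6)
    (hb : 36 * b = d + 3 * h (inr ()) ^ 2) :
    ((Matrix.toBilin' (kumGram 2)).restrict ((Matrix.toBilin' (kumGram 2)).orthogonal (ℤ ∙ h))).Equivalent
      ((hyperbolicSum 2).prod (Matrix.toBilin' !![-(2 * b), h (inr ()); h (inr ()), -6])) := by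
  have h1 := kum_restrict_orthogonal_equivalent_of_divisor (n := 2) (f := 6) (a := h (inr ())) (b := b) (d := d)
    (by norm_num) hh hfh hh' (by push_cast; linarith) (by push_cast; ring)
  norm_num at h1
  exact h1

end KummerFour

end Literature.AlgebraicGeometry.Hyperkaehler
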